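import Literature.NumberTheory.Rogawski1990.DepthZeroKappaTransferTypeOneGSideOfCountTrace                  -- ★ p852209 (this seat): §1 `…_of_split_trace_of_count` = ★ p851882 ∘ ★ p852176, modulo the two export counts `hX₀ hX₁`
import Literature.NumberTheory.Rogawski1990.UnitOrbitalIntegralInertValueThetaZeroAdicCompletionTrace   -- ★ (C5)′ EXPORT θ̄ = 0 at `(L, w)` (F0P3a-p02 (g23)): `UnitaryGroup.natCard_fixedPoints_unitaryInt_traceTorus_eq_phiZero_adicCompletion`
import Literature.NumberTheory.Rogawski1990.UnitOrbitalIntegralInertValueThetaOneAdicCompletionTrace    -- ★ (C5)′ EXPORT θ̄ = 1 at `(L, w)` (F0P3a-p02 (g23)): `UnitaryGroup.natCard_fixedPoints_unitaryInt_traceTorusPi_eq_phiOne_adicCompletion`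
import Literature.NumberTheory.Automorphic.AdicCompletionIntegersAdicComplete                           -- ★ p842102 `isAdicComplete_maximalIdeal_valuedInteger_adicCompletion` (the exports' instance binder)
import HarnessLib

/-!
# The depth-zero κ-transfer, type (1): the G-SIDE in the TRACE frame — CLOSED (every residue characteristic)

Topic `NumberTheory/Rogawski1990`; namespace `Literature.NumberTheory.Rogawski1990`.  THEOREMS ONLY (no definition, no instance, no notation, no named fact,
no `sorry`); kernel lane `--supports stmt-HodgeConjecture-24833`; count-neutral.  Cell `pub/hodgecm-mathlib`, crux H413, (C6) LAYER-C re-type, brick (C6)-6 top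
STAGE 2 (dealer LH4-plan (g7) WORDS #55∕#58∕#69∕#78 (i′)).

* `finsum_finExplicitDelta_mul_classOrbitalIntegral_depthZero_eq_of_split_trace_closed` — ★ p851882
  `finsum_finExplicitDelta_mul_classOrbitalIntegral_depthZero_eq_of_split_trace` with BOTH LAYER-B count hypotheses `hCOne hCPi` DISCHARGED and NO export
  hypothesis left: ★ §1 `…_of_count` (p852209) applied to the two (C5)′ inert EXPORT counts at `(L, w)`, ★
  `UnitaryGroup.natCard_fixedPoints_unitaryInt_traceTorus_eq_phiZero_adicCompletion` (θ̄ = 0, `#Fix = φ₀` in Flicker's triangle) and ★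
  `UnitaryGroup.natCard_fixedPoints_unitaryInt_traceTorusPi_eq_phiOne_adicCompletion` (θ̄ = 1, `#Fix = φ₁`); their instance binder `[IsAdicComplete 𝓂_w 𝒪_w]` is
  supplied by ★ `isAdicComplete_maximalIdeal_valuedInteger_adicCompletion` (p842102), so the head grows NO binder beyond ★ p851882's own plus the trace datum's
  `(hbv : |b|_w ≤ 1) (hbδ : |σ b − b|_w = 1)`.  Conclusion byte-identical with ★ p851882.

## References
* [Rogawski1990] J. D. Rogawski, *Automorphic Representations of Unitary Groups in Three Variables*, Ann. of Math. Stud. 123 (1990): §4.9 Prop. 4.9.1 (a)(b) p. 55,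
  Lemma 4.9.3 p. 56; §4.3 (4.3.1)–(4.3.2) p. 43.
* [Flicker1998UnitaryFL] Y. Z. Flicker, *Elementary proof of the fundamental lemma for a unitary group*, Canad. J. Math. 50 (1998): Prop. 3 p. 78, Props. 11–14
  pp. 87–94, §6 Thm. 15 p. 95.
* [Kottwitz1986] R. Kottwitz, *Base change for unit elements of Hecke algebras*, Compositio Math. 60 (1986): §3.
-/

set_option autoImplicit false

noncomputable section

open MeasureTheory Measure Set Function NumberField IsDedekindDomain Matrix Polynomial Topology Filter
open Literature.NumberTheory.Automorphic Literature.NumberTheory.Automorphic.UnitaryGroup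
open Literature.NumberTheory.Automorphic.IntegralReduction
open Literature.NumberTheory.GaloisRepresentations Literature.NumberTheory.NumberFields Literature.NumberTheory.QuadraticForms
open Literature.NumberTheory.Automorphic.HermitianLattice (unitaryInt)
open scoped Matrix MatrixGroups ValuativeRel

namespace Literature.NumberTheory.Rogawski1990

variable (L : Type) [Field L] [NumberField L] [IsCMField L] {v : HeightOneSpectrum (𝓞 ↥(maximalRealSubfield L))} (H' : Matrix (Fin 3) (Fin 3) L)

set_option synthInstance.maxHeartbeats 200000 in
set_option maxHeartbeats 4000000 in  -- as ★ p851882: the 120-line head itself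
open scoped Classical in
/-- **THE G-SIDE OF THE TYPE-(1) CLAUSE AT A DEPTH-ZERO PIECE, IN THE TRACE FRAME — CLOSED (every residue characteristic).**  ★ p851882
`finsum_finExplicitDelta_mul_classOrbitalIntegral_depthZero_eq_of_split_trace` with BOTH LAYER-B hypotheses `(hCOne) (hCPi)` DISCHARGED: §1 `…_of_count` applied to
the two (C5)′ inert EXPORT counts ★ `UnitaryGroup.natCard_fixedPoints_unitaryInt_traceTorus_eq_phiZero_adicCompletion` (θ̄ = 0) ∕ ★
`UnitaryGroup.natCard_fixedPoints_unitaryInt_traceTorusPi_eq_phiOne_adicCompletion` (θ̄ = 1) at `(L, w)` (their instance binder `[IsAdicComplete 𝓂_w 𝒪_w]` supplied by ★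
`isAdicComplete_maximalIdeal_valuedInteger_adicCompletion`).  Binders = ★ p851882's minus `hCOne hCPi` plus `(hbv) (hbδ)`; conclusion byte-identical.
[cite: Rogawski1990, §4.9 Prop. 4.9.1 (a)(b) p. 55; §4.3 (4.3.1)–(4.3.2) p. 43] [cite: Flicker1998UnitaryFL, Prop. 3 p. 78; Props. 11–14 pp. 87–94; §6 Thm. 15 p. 95]
[cite: Kottwitz1986, §3] -/
theorem finsum_finExplicitDelta_mul_classOrbitalIntegral_depthZero_eq_of_split_trace_closed
    (hH' : (H'.map (IsCMField.complexConj L))ᵀ = H') (w : PlacesOver L v)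
    (hw : IsCMField.complexConj L • w.1 = w.1) (hv : Algebra.IsUnramifiedIn (𝓞 L) v.asIdeal)
    (hH'w : IsUnit (placeForm H' w.1)) (hH'i : hH'w.unit ∈ glInt 3 (w.1.adicCompletion L))
    (μ : HeckeCharacter L) (hμ : μ.IsUnramifiedAt w.1)
    [∀ γ : ((cmDatum L 3 H').Local v), MeasurableSpace (((cmDatum L 3 H').Local v) ⧸ Subgroup.centralizer ({γ} : Set ((cmDatum L 3 H').Local v)))]
    (hl : ∀ (v : HeightOneSpectrum (𝓞 ↥(maximalRealSubfield L)))
      (a : (cmDatum L 2 (Matrix.of fun i j : Fin 2 => if i.val + j.val + 1 = 2 then (1 : L) else 0)).Local v ×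
      (cmDatum L 1 (Matrix.of fun i j : Fin 1 => if i.val + j.val + 1 = 1 then (1 : L) else 0)).Local v)
      (b : (cmDatum L 3 H').Local v)
      (x : (cmDatum L 2 (Matrix.of fun i j : Fin 2 => if i.val + j.val + 1 = 2 then (1 : L) else 0)).Local v ×
      (cmDatum L 1 (Matrix.of fun i j : Fin 1 => if i.val + j.val + 1 = 1 then (1 : L) else 0)).Local v),
      finExplicitDelta L v H' (x * a * x⁻¹) μ b = finExplicitDelta L v H' a μ b)
    (hr : ∀ (v : HeightOneSpectrum (𝓞 ↥(maximalRealSubfield L)))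
      (a : (cmDatum L 2 (Matrix.of fun i j : Fin 2 => if i.val + j.val + 1 = 2 then (1 : L) else 0)).Local v ×
      (cmDatum L 1 (Matrix.of fun i j : Fin 1 => if i.val + j.val + 1 = 1 then (1 : L) else 0)).Local v)
      (b y : (cmDatum L 3 H').Local v),
      finExplicitDelta L v H' a μ (y * b * y⁻¹) = finExplicitDelta L v H' a μ b)
    (hH'u : IsUnit H')
    (hμω : ∀ x : ideleGroup ↥(maximalRealSubfield L), μ (AdeleRing.ideleBaseChange ↥(maximalRealSubfield L) L x) = quadraticHeckeCharCM L x)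
    {γH : ((cmDatum L 2 (Matrix.of fun i j : Fin 2 => if i.val + j.val + 1 = 2 then (1 : L) else 0)).Local v ×
      (cmDatum L 1 (Matrix.of fun i j : Fin 1 => if i.val + j.val + 1 = 1 then (1 : L) else 0)).Local v)}
    -- the split eigen-data of `stub_splitExponents`
    (α γ : w.1.adicCompletion L) (N₁ N₂ : ℕ)
    (hα : ((((γH.1.val : GL (Fin 2) (LocalRing L v)) : Matrix (Fin 2) (Fin 2) (LocalRing L v)).charpoly).map
        (Pi.evalRingHom (fun w' : PlacesOver L v => w'.1.adicCompletion L) w)).IsRoot α)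
    (hγ : ((((γH.1.val : GL (Fin 2) (LocalRing L v)) : Matrix (Fin 2) (Fin 2) (LocalRing L v)).charpoly).map
        (Pi.evalRingHom (fun w' : PlacesOver L v => w'.1.adicCompletion L) w)).IsRoot γ)
    (hαγ : α ≠ γ)
    (hN₁ : Valued.v (α - finGammaTwo L v γH w) = WithZero.exp (-(N₁ : ℤ)))
    (hN₂ : Valued.v (γ - finGammaTwo L v γH w) = WithZero.exp (-(N₂ : ℤ)))
    -- the 2-free scalars of the trace frame (★ `exists_traceFrame_scalars_of_nonsplit'`) and an eigenframe of `g` over `E_v` (★ (E1))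
    {b ε π π' a d : LocalRing L v} (hb : b + conjLocal L (IsCMField.complexConj L) v b = 1) (hσπ : conjLocal L (IsCMField.complexConj L) v π = π) (hππ : π * π' = 1)
    (hπN : ∀ z : LocalRing L v, conjLocal L (IsCMField.complexConj L) v z * z ≠ π)
    (hbv : Valued.v (b w) ≤ 1) (hbδ : Valued.v ((conjLocal L (IsCMField.complexConj L) v b - b) w) = 1)  -- (R-bv)∕T7: the trace datum is integral with unit discriminant at `w`
    (hε : conjLocal L (IsCMField.complexConj L) v ε * ε = -1)
    (ha1 : conjLocal L (IsCMField.complexConj L) v a * a = 1) (hd1 : conjLocal L (IsCMField.complexConj L) v d * d = 1)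
    {P₂ : GL (Fin 2) (LocalRing L v)} (hP₂ : (γH.1.val.val : Matrix (Fin 2) (Fin 2) (LocalRing L v)) * P₂.val = P₂.val * diagonal ![a, d])
    (had : a ≠ d) (hab : a ≠ finGammaTwo L v γH) (hbd : finGammaTwo L v γH ≠ d)
    (hu0 : a w = α) (hu1w : d w = γ) (N : ℕ) (hN : Valued.v (α - γ) = WithZero.exp (-(N : ℤ)))
    (htri : (N₁ = N₂ ∧ N₁ ≤ N) ∨ (N₁ = N ∧ N₁ ≤ N₂) ∨ (N₂ = N ∧ N₂ ≤ N₁))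
    (hα1 : Valued.v (α - 1) < 1) (hγ1 : Valued.v (γ - 1) < 1) (hb1 : Valued.v (finGammaTwo L v γH w - 1) < 1)
    [MeasurableSpace ((cmDatum L 3 H').Local v)] [BorelSpace ((cmDatum L 3 H').Local v)]
    [∀ γ : ((cmDatum L 3 H').Local v), BorelSpace (((cmDatum L 3 H').Local v) ⧸ Subgroup.centralizer ({γ} : Set ((cmDatum L 3 H').Local v)))]
    (νG : Measure ((cmDatum L 3 H').Local v)) [νG.IsHaarMeasure] [νG.IsMulRightInvariant]
    {mG : OrbitalMeasureFamily ((cmDatum L 3 H').Local v)}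
    (hmG : mG.IsCanonical (fun γ => IsRegularElt (γ.val : GL (Fin 3) (UnitaryGroup.LocalRing L v))) νG)
    (g : ((cmDatum L 3 H').Local v) → ℂ) (hg : IsLocSmooth g) (hgK : tsupport g ⊆ (cmLocalIntegralLevel L 3 H' v : Set ((cmDatum L 3 H').Local v)))
    (hginv : ∀ u ∈ cmLocalIntegralLevel L 3 H' v, ∀ x, g (u * x * u⁻¹) = g x)
    (c : ℕ → ℂ)
    (hc : ∀ k ∈ cmLocalIntegralLevel L 3 H' v,
      (redMat (((k.val : GL (Fin 3) (UnitaryGroup.LocalRing L v)).val.map (Pi.evalRingHom (fun w' : PlacesOver L v => w'.1.adicCompletion L) w))) - 1) ^ 3 = 0 →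
      g k = c (redMat (((k.val : GL (Fin 3) (UnitaryGroup.LocalRing L v)).val.map (Pi.evalRingHom (fun w' : PlacesOver L v => w'.1.adicCompletion L) w))) - 1).rank)
    -- LAYER B's two count heads, as hypotheses (θ̄ = 0 literal `t₁^{(b)}`, θ̄ = 1 literal `t_π^{(b)}`)
    : ∑ᶠ cG : ConjClasses ((cmDatum L 3 H').Local v),
        (finExplicitCollection L H' μ hl hr v).Δ γH (Quotient.out cG) * classOrbitalIntegral mG g cG =
      (νG.real (cmLocalIntegralLevel L 3 H' v : Set ((cmDatum L 3 H').Local v)) : ℂ) *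
        (((((Ideal.absNorm v.asIdeal : ℂ)) ^ 2)⁻¹ * c 0 + ((((Ideal.absNorm v.asIdeal : ℂ)) ^ 2 - 1) / ((Ideal.absNorm v.asIdeal : ℂ)) ^ 2) * c 1) *
          ((Flicker1998.phiH (Ideal.absNorm v.asIdeal) (N - 1) : ℚ) : ℂ) +
        (-((Ideal.absNorm v.asIdeal : ℂ))⁻¹ * c 1 + ((((Ideal.absNorm v.asIdeal : ℂ)) + 1) / ((Ideal.absNorm v.asIdeal : ℂ))) * c 2) *
          ((Flicker1998.phiH (Ideal.absNorm v.asIdeal) N - Flicker1998.phiH (Ideal.absNorm v.asIdeal) (N - 1) : ℚ) : ℂ)) := by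
  haveI := isAdicComplete_maximalIdeal_valuedInteger_adicCompletion L w.1  -- ★ p842102: `𝒪_w` is `𝓂`-adically complete (the exports bind it as an instance)
  exact finsum_finExplicitDelta_mul_classOrbitalIntegral_depthZero_eq_of_split_trace_of_count L H' hH' w hw hv hH'w hH'i μ hμ hl hr hH'u hμω α γ N₁ N₂
    hα hγ hαγ hN₁ hN₂ hb hσπ hππ hπN hbv hbδ hε ha1 hd1 hP₂ had hab hbd hu0 hu1w N hN htri hα1 hγ1 hb1 νG hmG g hg hgK hginv c hc
    (fun {b₀} hb₀ hb₀v hb₀δ {a₁ a₂ a₃} ha₁ ha₂ ha₃ {t₀} hte {N' N₁' N₂'} hN hN₁ hN₂ htri₀ hfin =>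
      UnitaryGroup.natCard_fixedPoints_unitaryInt_traceTorus_eq_phiZero_adicCompletion L w hw hv hb₀ hb₀v hb₀δ ha₁ ha₂ ha₃ hte hN hN₁ hN₂ htri₀ hfin)
    (fun {b₀} hb₀ hb₀v hb₀δ {a₁ a₂ a₃ ϖ₁ ϖ₁'} ha₁ ha₂ ha₃ hσϖ hϖϖ hϖN {t₀} hte {N' N₁' N₂'} hN hN₁ hN₂ hfin =>
      UnitaryGroup.natCard_fixedPoints_unitaryInt_traceTorusPi_eq_phiOne_adicCompletion L w hw hv hb₀ hb₀v hb₀δ ha₁ ha₂ ha₃ hσϖ hϖϖ hϖN hte hN hN₁ hN₂ hfin)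

end Literature.NumberTheory.Rogawski1990

end
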